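import Summits.QuantumAdvantage.QuantumAdvantage.Theorems.CubicForrelationNearExactIsExactTwelveWindowShape30
import Summits.QuantumAdvantage.QuantumAdvantage.Theorems.CubicForrelationNearExactIsExactFlatSumsGeneral
import Summits.QuantumAdvantage.QuantumAdvantage.Theorems.CubicForrelationNearExactIsExactFlatSecondWeight
import Summits.QuantumAdvantage.QuantumAdvantage.Theorems.CubicForrelationNearExactIsExactZeroModSixDigits
import Summits.QuantumAdvantage.QuantumAdvantage.Theorems.CubicForrelationNearExactIsExactCubicEvenOnFourFlat

/-!
# Crux `CubicForrelation.NearExactIsExact` (stmt-QuantumAdvantage-14043) — n = 12, WEIGHT OF A TYPE-O CUBIC, I: the TYPE PRINCIPLE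
  for 9-flats (residue `mod 8` of the number of ones on the cosets of the annihilator of three frequencies) and the
  Kasami–Tokura bound `≥ 132` for an odd 9-flat

Certificate seat `b2b-cforr-cert` (gen 32).  HONEST FRAMING: kernel-checked finite-slice lemmas (standard axioms) about a single cubic Boolean
function on 12 bits whose Walsh spectrum is `16 × odd` ("type O", equivalently weight `≡ 8 (mod 16)`).  They are the tools of the theorem
"a type-O cubic on 12 bits has weight `≥ 1280`" (…TwelveOddWeight*), which empties the "`κ₁` type O" branch of the wild (O,O) analysis of
the open window `(57/64, 29/32)` (PLAN-N12-WINDOW-OO.md §5–6: there `1024 < #E₁ = wt κ₁ ≤ 1272`).  NOT summit progress; no value of `θ₁₂`.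

* `tow_W_shift`: `W_{κ(·⊕p)}(y) = (−1)^{p·y} W_κ(y)`.
* `tow_affine_sum3`, `tow_signed_digit_sum`: signed sums of affine functions on `𝔽₂³` lie in `{0, ±8}`; hence for affine `ℓ, φ`, any `ψ, r`:
  `Σ_ε (−1)^{ℓ(ε)} (1 + 2[φ ε] + 4[ψ ε] + 8 r ε) ≡ 4·#{ψ} (mod 8)`.
* `tow_flat_type` (**TYPE PRINCIPLE**): `κ` cubic with `W_κ = 16u`, all `u` odd; three frequencies `a₀,a₁,a₂` whose annihilator `T` has `512`
  points; then for EVERY `p`, `#{x ∈ p ⊕ T : κ x} ≡ 4·N (mod 8)` with `N = #{ε ∈ 𝔽₂³ : d₂(⊕ εᵢaᵢ)}`, `d₂ = [⌊u/4⌋ odd]` — the residue does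
  not depend on the coset.  [Poisson for `κ(·⊕p)` over the frequency flat `⟨a⟩` (`fs_sum_W_flat`): `#{…} = 256 − Σ_ε (−1)^{p·a_ε} u(a_ε)`;
  `u = 1 + 2d₁ + 4d₂ + 8r` with `d₁` AFFINE (`z2_digitOne`), and the signed digit sum.]
* `tow_flat9_kt`: for cubic `κ` and such `T`, `#{x ∈ p ⊕ T : κ x} ≡ 4 (mod 8)` forces `#{…} ≥ 132` (relative Kasami–Tokura `ffw_kt3_weights`:
  below `128` only `0, 64, 96, 112, 120`).

References: T. Kasami, N. Tokura (1970) Thm 1; R. J. McEliece (1972); C. Carlet (2021) §4.1; R. O'Donnell (2014) §3.3.  Axioms: the standard three.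
-/

set_option linter.dupNamespace false -- D-0017: single-problem summit ⇒ `QuantumAdvantage.QuantumAdvantage` by design

noncomputable section

namespace Summit.QuantumAdvantage.QuantumAdvantage.Theorems.CubicForrelation.NearExactIsExact

open Finset
open Literature.Computability.QuantumComplexity
open Literature.Computability.QuantumComplexity.BuzetChailloux (bxor zeroVec bxor_bxor_cancel_left bxor_zeroVec zeroVec_bxor bxor_comm
  bxor_self twist_bxor_right twist_zeroVec_right sum_twist_left bxor_eq_zeroVec_iff)
open Literature.Computability.QuantumComplexity.DerivativeWalsh (W twist_bxor_left)
open Summit.QuantumAdvantage.QuantumAdvantage.Theorems.SignedCubicForrelationNotPrBPP (knf_isDegLeFun_ip)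

/-! ### Walsh transform of a translate -/

/-- `W_{κ(·⊕p)}(y) = (−1)^{p·y}·W_κ(y)`. [cite: ODonnell2014, §1.4] -/
theorem tow_W_shift {n : ℕ} (κ : (Fin n → Bool) → Bool) (p y : Fin n → Bool) :
    W (fun x => signOf (κ (bxor x p))) y = twist p y * W (fun x => signOf (κ x)) y := by
  classical
  unfold W
  rw [mul_sum]
  refine Fintype.sum_equiv (Literature.Computability.QuantumComplexity.BuzetChailloux.bxorPerm p) _ _ fun x => ?_
  rw [Literature.Computability.QuantumComplexity.BuzetChailloux.bxorPerm_apply]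
  dsimp only
  rw [bxor_comm x p, twist_bxor_left]
  have h := Literature.Computability.QuantumComplexity.Simon.twist_mul_self p y
  linear_combination (-(signOf (κ (bxor p x)) * twist x y)) * h

/-- `Σ_{x ∈ S} (−1)^{κ x} = #S − 2·#{x ∈ S : κ x}`. [folklore] -/
theorem tow_sum_signOf_eq {n : ℕ} (S : Finset (Fin n → Bool)) (κ : (Fin n → Bool) → Bool) :
    ∑ x ∈ S, signOf (κ x) = (#S : ℝ) - 2 * #(S.filter fun x => κ x = true) := by
  have e : ∀ x, signOf (κ x) = 1 - 2 * (if κ x = true then (1 : ℝ) else 0) := fun x => by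
    cases κ x <;> norm_num [signOf]
  rw [sum_congr rfl fun x _ => e x, sum_sub_distrib, sum_const, nsmul_eq_mul, mul_one, ← mul_sum, sum_boole]

/-! ### Signed sums of affine functions on three bits -/

/-- The signed sum of an affine Boolean function on `𝔽₂³` is `0` or `±8`. [cite: Carlet2020, §2.2] -/
theorem tow_affine_sum3 (h : (Fin 3 → Bool) → Bool) (hh : IsDegLeFun 1 h) :
    ∑ ε, sZ (h ε) = 0 ∨ ∑ ε, sZ (h ε) = 8 ∨ ∑ ε, sZ (h ε) = -8 := by
  rcases qb_affine_dichotomy hh with hc | hb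
  · right
    have e : ∑ ε : Fin 3 → Bool, sZ (h ε) = ∑ _ε : Fin 3 → Bool, sZ (h zeroVec) :=
      sum_congr rfl fun ε _ => by rw [hc ε]
    rw [e, sum_const, card_univ, Fintype.card_fun, Fintype.card_bool, Fintype.card_fin, nsmul_eq_mul]
    rcases tp_sZ_cases (h zeroVec) with h1 | h1 <;> rw [h1] <;> norm_num
  · left
    have h' : ((∑ ε : Fin 3 → Bool, sZ (h ε) : ℤ) : ℝ) = ((0 : ℤ) : ℝ) := by
      rw [Int.cast_sum, Int.cast_zero, ← hb]
      exact sum_congr rfl fun ε _ => tp_sZ_cast (h ε)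
    exact_mod_cast h'

/-- **Signed digit sum.**  For affine `ℓ, φ : 𝔽₂³ → 𝔽₂`, any `ψ` and any integer `r`:
`Σ_ε (−1)^{ℓ ε}·(1 + 2[φ ε] + 4[ψ ε] + 8 r ε) ≡ 4·#{ψ} (mod 8)`.  [`(−1)^ℓ·2[φ] = (−1)^ℓ − (−1)^{ℓ⊕φ}` and both signed sums are in
`{0, ±8}`; `(−1)^ℓ[ψ] ≡ [ψ] (mod 2)`.] [this work] -/
theorem tow_signed_digit_sum (ℓ φ ψ : (Fin 3 → Bool) → Bool) (r : (Fin 3 → Bool) → ℤ)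
    (hℓ : IsDegLeFun 1 ℓ) (hφ : IsDegLeFun 1 φ) :
    (∑ ε, sZ (ℓ ε) * (1 + 2 * (if φ ε = true then 1 else 0) + 4 * (if ψ ε = true then 1 else 0) + 8 * r ε)) % 8 =
      (4 * (#(univ.filter fun ε : Fin 3 → Bool => ψ ε = true) : ℤ)) % 8 := by
  have hS0 := tow_affine_sum3 ℓ hℓ
  have hS1 := tow_affine_sum3 (fun ε => ℓ ε ^^ φ ε) (bb_isDegLeFun_bxor hℓ hφ)
  have e : ∀ ε, sZ (ℓ ε) * (1 + 2 * (if φ ε = true then 1 else 0) + 4 * (if ψ ε = true then 1 else 0) + 8 * r ε) =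
      sZ (ℓ ε) + (sZ (ℓ ε) - sZ (ℓ ε ^^ φ ε)) + 4 * (if ψ ε = true then (1 : ℤ) else 0) +
        8 * (sZ (ℓ ε) * r ε - (if ℓ ε = true then 1 else 0) * (if ψ ε = true then 1 else 0)) := by
    intro ε
    cases ℓ ε <;> cases φ ε <;> cases ψ ε <;> simp [sZ] <;> ring
  rw [sum_congr rfl fun ε _ => e ε, sum_add_distrib, sum_add_distrib, sum_add_distrib, sum_sub_distrib, ← mul_sum, ← mul_sum,
    sum_boole]
  rcases hS0 with h0 | h0 | h0 <;> rcases hS1 with h1 | h1 | h1 <;> simp only [h0, h1] <;> omega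

/-! ### The type principle -/

/-- **TYPE PRINCIPLE for 9-flats.**  `κ` cubic on 12 bits with `W_κ = 16u`, every `u` odd (type O).  For three frequencies
`a₀, a₁, a₂` whose annihilator `T = {x : aᵢ·x = 0 ∀ i}` has `512` points and ANY translation `p`:
`#{x ∈ p ⊕ T : κ x} ≡ 4·#{ε ∈ 𝔽₂³ : ⌊u(⊕_{εᵢ} aᵢ)/4⌋ odd} (mod 8)` — the residue does not depend on `p`. [this work] -/
theorem tow_flat_type (κ : (Fin (6 + 6) → Bool) → Bool) (hκ : IsDegLeFun 3 κ) (u : (Fin (6 + 6) → Bool) → ℤ)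
    (hu : ∀ y, W (fun x => signOf (κ x)) y = (2 : ℝ) ^ 4 * (u y : ℝ)) (hodd : ∀ y, Odd (u y))
    (a : Fin 3 → Fin (6 + 6) → Bool)
    (hT : #(univ.filter fun x : Fin (6 + 6) → Bool => ∀ i, twist (a i) x = 1) = 512) (p : Fin (6 + 6) → Bool) :
    ((#(((univ.filter fun x : Fin (6 + 6) → Bool => ∀ i, twist (a i) x = 1).image (bxor p)).filter
        fun x => κ x = true) : ℤ)) % 8 =
      (4 * (#(univ.filter fun ε : Fin 3 → Bool =>
        decide (Odd (u (fun j => zeroVec j ^^ decide (Odd #(univ.filter fun i => ε i && a i j))) / 2 / 2)) = true) : ℤ)) % 8 := by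
  classical
  set T := univ.filter (fun x : Fin (6 + 6) → Bool => ∀ i, twist (a i) x = 1) with hTdef
  set pt : (Fin 3 → Bool) → (Fin (6 + 6) → Bool) :=
    fun ε j => zeroVec j ^^ decide (Odd #(univ.filter fun i => ε i && a i j)) with hptdef
  set cnt := #((T.image (bxor p)).filter fun x => κ x = true) with hcntdef
  -- Poisson for the translated cubic over the frequency flat `⟨a⟩`
  have hP := fs_sum_W_flat (fun x => signOf (κ (bxor x p))) zeroVec a
  have hL : ∀ ε, W (fun x => signOf (κ (bxor x p))) (pt ε) = twist p (pt ε) * ((2 : ℝ) ^ 4 * (u (pt ε) : ℝ)) :=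
    fun ε => by rw [tow_W_shift, hu]
  have hinj : Function.Injective (bxor p) := fun x y hxy => by
    have := congrArg (bxor p) hxy
    rwa [bxor_bxor_cancel_left, bxor_bxor_cancel_left] at this
  have hR : ∑ y ∈ T, signOf (κ (bxor y p)) * twist zeroVec y = (512 : ℝ) - 2 * cnt := by
    have e1 : ∀ y : Fin (6 + 6) → Bool, twist zeroVec y = 1 := fun y => by
      rw [Literature.Computability.QuantumComplexity.twist_comm, twist_zeroVec_right]
    rw [sum_congr rfl fun y _ => by rw [e1 y, mul_one]]
    have e2 : ∑ y ∈ T, signOf (κ (bxor y p)) = ∑ x ∈ T.image (bxor p), signOf (κ x) := by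
      rw [sum_image fun x _ y _ h => hinj h]
      exact sum_congr rfl fun y _ => by rw [bxor_comm]
    rw [e2, tow_sum_signOf_eq, card_image_of_injective _ hinj, hT, ← hcntdef]
    norm_num
  rw [sum_congr rfl fun ε _ => hL ε, hR] at hP
  -- the signs `(−1)^{p·a_ε}` as integers
  set ℓ : (Fin 3 → Bool) → Bool := fun ε => decide (Odd #(univ.filter fun i => pt ε i && p i)) with hℓdef
  have hτ : ∀ ε, twist p (pt ε) = ((sZ (ℓ ε) : ℤ) : ℝ) := fun ε => by
    rw [Literature.Computability.QuantumComplexity.twist_comm, vg_twist_eq_signOf, tp_sZ_cast]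
  have key : (∑ ε, sZ (ℓ ε) * u (pt ε) : ℤ) = 256 - cnt := by
    have h2 : ∑ ε, twist p (pt ε) * ((2 : ℝ) ^ 4 * (u (pt ε) : ℝ)) = 16 * ∑ ε, ((sZ (ℓ ε) : ℤ) : ℝ) * (u (pt ε) : ℝ) := by
      rw [mul_sum]
      exact sum_congr rfl fun ε _ => by rw [hτ ε]; ring
    rw [h2] at hP
    have h3 : ((∑ ε, sZ (ℓ ε) * u (pt ε) : ℤ) : ℝ) = ((256 - (cnt : ℤ) : ℤ) : ℝ) := by
      push_cast
      linarith
    exact_mod_cast h3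
  -- digits: `u = 1 + 2 d₁ + 4 d₂ + 8 r`, `d₁` affine
  have hu' : ∀ y, W (fun x => signOf (κ x)) y = (2 : ℝ) ^ (2 * 2) * (u y : ℝ) := fun y => (hu y).trans (by norm_num)
  have hd1 : IsDegLeFun 1 (fun y => decide (Odd (u y / 2))) := z2_digitOne 2 κ u hκ hu' hodd
  have hℓ : IsDegLeFun 1 ℓ :=
    fs_deg_pullback (fun x : Fin (6 + 6) → Bool => decide (Odd #(univ.filter fun i => x i && p i))) (knf_isDegLeFun_ip p) zeroVec a
  have hφ : IsDegLeFun 1 (fun ε => decide (Odd (u (pt ε) / 2))) := fs_deg_pullback _ hd1 zeroVec a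
  have hdec : ∀ y, u y = 1 + 2 * (if decide (Odd (u y / 2)) = true then 1 else 0) +
      4 * (if decide (Odd (u y / 2 / 2)) = true then 1 else 0) + 8 * (u y / 2 / 2 / 2) := by
    intro y
    have h1 := td_two_mul_div_add (u y)
    have h2 := td_two_mul_div_add (u y / 2)
    have h3 := td_two_mul_div_add (u y / 2 / 2)
    rw [if_pos (hodd y)] at h1
    simp only [decide_eq_true_eq]
    by_cases ha : Odd (u y / 2) <;> by_cases hb : Odd (u y / 2 / 2) <;> simp only [ha, hb, if_true, if_false] at h2 h3 ⊢ <;> omega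
  have hmod := tow_signed_digit_sum ℓ (fun ε => decide (Odd (u (pt ε) / 2))) (fun ε => decide (Odd (u (pt ε) / 2 / 2)))
    (fun ε => u (pt ε) / 2 / 2 / 2) hℓ hφ
  have hsum : (∑ ε, sZ (ℓ ε) * u (pt ε) : ℤ) =
      ∑ ε, sZ (ℓ ε) * (1 + 2 * (if decide (Odd (u (pt ε) / 2)) = true then 1 else 0) +
        4 * (if decide (Odd (u (pt ε) / 2 / 2)) = true then 1 else 0) + 8 * (u (pt ε) / 2 / 2 / 2)) :=
    sum_congr rfl fun ε _ => by rw [← hdec (pt ε)]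
  rw [hsum] at key
  rw [key] at hmod
  simp only [hptdef] at hmod
  omega

/-! ### Kasami–Tokura on a 9-flat: an odd count is at least `132` -/

/-- The annihilator of any family of frequencies is xor-closed and contains `0`. [folklore] -/
theorem tow_annihilator_closed {n k : ℕ} (a : Fin k → Fin n → Bool) :
    zeroVec ∈ univ.filter (fun x : Fin n → Bool => ∀ i, twist (a i) x = 1) ∧
      ∀ x ∈ univ.filter (fun x : Fin n → Bool => ∀ i, twist (a i) x = 1),
        ∀ y ∈ univ.filter (fun x : Fin n → Bool => ∀ i, twist (a i) x = 1),
          bxor x y ∈ univ.filter (fun x : Fin n → Bool => ∀ i, twist (a i) x = 1) := by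
  refine ⟨mem_filter.2 ⟨mem_univ _, fun i => twist_zeroVec_right _⟩, fun x hx y hy => mem_filter.2 ⟨mem_univ _, fun i => ?_⟩⟩
  rw [twist_bxor_right, (mem_filter.1 hx).2 i, (mem_filter.1 hy).2 i, one_mul]

/-- **Odd 9-flats are heavy.**  `κ` cubic on 12 bits, `T` the annihilator of three frequencies with `#T = 512`, `p` any point:
if `#{x ∈ p ⊕ T : κ x} ≡ 4 (mod 8)` then `#{x ∈ p ⊕ T : κ x} ≥ 132` (a cubic on a 9-flat with fewer than `128` ones has
`0, 64, 96, 112` or `120` of them — relative Kasami–Tokura, `ffw_kt3_weights` — and `128 ≢ 4`). [cite: KasamiTokura1970, Thm 1] -/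
theorem tow_flat9_kt (κ : (Fin (6 + 6) → Bool) → Bool) (hκ : IsDegLeFun 3 κ) (a : Fin 3 → Fin (6 + 6) → Bool)
    (hT : #(univ.filter fun x : Fin (6 + 6) → Bool => ∀ i, twist (a i) x = 1) = 512) (p : Fin (6 + 6) → Bool)
    (h4 : #(((univ.filter fun x : Fin (6 + 6) → Bool => ∀ i, twist (a i) x = 1).image (bxor p)).filter fun x => κ x = true) % 8 = 4) :
    132 ≤ #(((univ.filter fun x : Fin (6 + 6) → Bool => ∀ i, twist (a i) x = 1).image (bxor p)).filter fun x => κ x = true) := by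
  classical
  set T := univ.filter (fun x : Fin (6 + 6) → Bool => ∀ i, twist (a i) x = 1) with hTdef
  obtain ⟨h0, hadd⟩ := tow_annihilator_closed a
  have hflat : ∀ b ∈ T.image (bxor p), ∀ d : Fin (3 + 1) → Fin (6 + 6) → Bool, (∀ i, d i ∈ T) →
      Even #(univ.filter fun ε : Fin (3 + 1) → Bool => κ (fun j => b j ^^ decide (Odd #(univ.filter fun i => ε i && d i j))) = true) :=
    fun b _ d _ => cf_even_card_of_cubic_four (fs_deg_pullback κ hκ b d)
  by_contra hlt
  push Not at hlt
  have h512 : #T = 2 ^ 9 := by rw [hT]; norm_num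
  rcases ffw_kt3_weights T h0 hadd h512 p κ hflat (by omega) with h | ⟨s, hs, hs2⟩ | h
  · omega
  · have hsle : s ≤ 9 := by
      by_contra hcon
      have : 2 ^ 10 ≤ 2 ^ s := Nat.pow_le_pow_right (by norm_num) (by omega)
      omega
    interval_cases s <;> omega
  · omega

end Summit.QuantumAdvantage.QuantumAdvantage.Theorems.CubicForrelation.NearExactIsExact

end
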